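import Summits.ABC.StewartYu.PadicG3TwoMain
import Summits.ABC.StewartYu.PadicG3TwoSlabKStepOn
import HarnessLib

/-!
# Cell abc-stewartyu, Gen-3 frame at `p = 2` (crux `Y07Two`, stmt-ABC-19659), layer F6 (sequel): the INNER CHAIN
# of the level induction discharged from the record's numeric inequalities — `KFinalTwo σ I ⇒ KChainTwo σ Sh I`

`Summits/ABC/StewartYu/PadicG3TwoMainChain.lean` — cell `abc-stewartyu` (HOME `run/shared/lean/pub/abc-stewartyu/`),
route `PadicPrimesKummerThird`, seat p5 (g3); sequel to `PadicG3TwoMain.lean` (F6).  One real-valued definition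
(the Liouville constant `KTwo`), one `ℕ`-valued definition (the gain exponent `gainExp`), one `Prop`-structure
(`KFinalTwo`, the record's obligations for the inner chain of level `I`), and the theorem
**`kchainTwo_of_kfinal : KFinalTwo σ I → KChainTwo σ Sh I`** for EVERY shape predicate `Sh` — twin of M2's
`PadicTwoMain.kchain3` from `KSizes3`/`KFinal3`.

THE CHAIN (Yu 2013 Lemma 5.2 = `r` sub-steps per level; Nesterenko §4.1 stages `ν = 0, …, n`): at level `I` the
invariant `InvTwo` gives an admissible family (`G3Adm σ Sh I Λ`: slab, box, weights, pointwise `Y₀`-weight data —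
exactly the hypotheses of the k-step) whose values vanish at the nodes `|x| ≤ N0 I` COPRIME TO `3` for
`|τ| < T0 I`.  Sub-step `0` is the k-step from the coprime nodes (`PadicG3TwoSlabKStepOn.g3_slab_kstep_cop`,
gain exponent `2(N − ⌊N/3⌋)·t`), sub-steps `k ≥ 1` are k-steps from all `2N_k+1` nodes (`g3_slab_kstep_Icc`),
each paying `t = tdec I` in the order and reaching the range `Nsub I (k+1)`; after `kst I ≥ 1` sub-steps the
values vanish at all `|x| ≤ Nfin I ≤ Nsub I (kst I)` for `|τ| < Tfin I ≤ T0 I − kst I·tdec I`.  The numeric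
input of sub-step `k` is literally the `hfinal` of the k-step with the Liouville constant
`KTwo σ I x τ = cardB I · P · (M₀ I x τ · Xb I^{|t|} · monDen(all, boxExp (Dbox I) (Dθ I) x)²)`.

WHAT THIS IS NOT: no choice of the schedule (record: p1/lp-1, `PadicG3Par` p = 2 column); no third step (F5);
no crux moves.

References: K. Yu, Acta Math. 211 (2013), Lemma 5.2 (5.23)–(5.31); Yu. V. Nesterenko, LNM 1819 (2003), §4.1
(4.3)–(4.5); K. Yu, Acta Arith. 53 (1989), §3 Lemma 3.3.
-/

noncomputable section

open Finset Polynomial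
open Literature.NumberTheory.Transcendental
open Literature.NumberTheory.Transcendental.CW77.Setup (Tau tauNorm)
open Literature.NumberTheory.Transcendental.PadicCW77 (condExp)

namespace Summit.ABC.StewartYu

namespace TwoSetup

variable {S : TwoSetup} {ι : Type*} (σ : S.G3TwoSched) (Sh : ℕ → S.G3Fam ι → Prop)

/-! ### The record's obligations for the inner chain of level `I` -/

/-- **The Liouville constant of level `I`** at the point `x` and the multi-index `τ`:
`cardB I · P · (M₀ I x τ · Xb I^{∑ tⱼ} · monDen(all, boxExp (Dbox I) (Dθ I) x)²)` — the `K` of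
`PadicG3TwoValues.g3φ_eq_zero_of_norm_lt` with the schedule's bounds. [cite: Yu2013, (5.35)–(5.40); shape only] -/
def KTwo (I : ℕ) (x : ℤ) (τ : Tau S.d) : ℝ :=
  (σ.cardB I : ℝ) * σ.P * (σ.M₀ I x τ * (σ.Xb I : ℝ) ^ (∑ j, τ.2 j) *
    ((MonomialDen.monDen S.toQ.all (S.boxExp (σ.Dbox I) (σ.Dθ I) x) : ℝ)) ^ 2)

/-- **The gain exponent of sub-step `k` at level `I`** (number of zeros counted with multiplicity `tdec I`):
`2(N − ⌊N/3⌋)·t` for the coprime sub-step `k = 0` (`N = Nsub I 0`), `(2N_k+1)·t` for `k ≥ 1`.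
[cite: Yu2013, Lemma 5.2 (5.27)–(5.28); shape only] -/
def gainExp (I k : ℕ) : ℕ :=
  if k = 0 then 2 * (σ.Nsub I 0 - σ.Nsub I 0 / 3) * σ.tdec I else (2 * σ.Nsub I k + 1) * σ.tdec I

/-- **THE RECORD'S OBLIGATIONS FOR THE INNER CHAIN OF LEVEL `I`**: consistency of the sub-schedule with the
level's ranges/orders, at least one sub-step, positive order decrement, sign conditions, and for every sub-step
`k < kst I` the numeric inequality of the `2`-adic k-step (`hfinal` of `g3_slab_kstep_cop`/`g3_slab_kstep_Icc`)
against the Liouville constant `KTwo`. [cite: Yu2013, Lemma 5.2 (5.28)–(5.31), (5.40)–(5.41); shape only] -/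
structure KFinalTwo (I : ℕ) : Prop where
  /-- the chain starts at the level's initial range -/
  Nsub_zero : σ.Nsub I 0 = σ.N0 I
  /-- the chain reaches the level's final range -/
  Nfin_le : σ.Nfin I ≤ σ.Nsub I (σ.kst I)
  /-- the chain's order budget -/
  Tfin_le : σ.Tfin I + σ.kst I * σ.tdec I ≤ σ.T0 I
  /-- at least one sub-step (the coprime one) -/
  one_le_kst : 1 ≤ σ.kst I
  /-- positive order decrement -/
  one_le_tdec : 1 ≤ σ.tdec I
  /-- the directional bound is a nonnegative number -/
  Xb_nonneg : 0 ≤ σ.Xb I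
  /-- the `Y₀`-weight denominators are positive -/
  one_le_den₀ : ∀ (x : ℤ) (τ : Tau S.d), 1 ≤ σ.den₀ I x τ
  /-- the Liouville constant is positive -/
  KTwo_pos : ∀ (x : ℤ) (τ : Tau S.d), 0 < KTwo σ I x τ
  /-- the numeric inequality of every sub-step -/
  hfinal : ∀ k, k < σ.kst I → ∀ x₁ : ℤ, |x₁| ≤ (σ.Nsub I (k + 1) : ℤ) → ∀ τ : Tau S.d,
    tauNorm τ + σ.tdec I ≤ σ.T0 I - k * σ.tdec I →
    max (σ.Bw I * ‖S.Λ₀‖ * (2 : ℝ) ^ σ.tdec I * (2 : ℝ) ^ condExp 2 (2 * σ.Nsub I k + 1) (σ.tdec I))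
        (σ.Bw I / (4 * (2 : ℝ) ^ σ.m) ^ gainExp σ I k) < 1 / KTwo σ I x₁ τ

/-! ### The inner chain, proved -/

/-- The hypotheses of the generic k-step from admissibility: sign facts and the Liouville-constant comparison.
[folklore] -/
theorem kstep_data_of_adm {I : ℕ} {Λ : S.G3Fam ι} (hadm : S.G3Adm σ Sh I Λ) (hXb : 0 ≤ σ.Xb I) :
    0 ≤ σ.Bw I ∧ 0 ≤ σ.P ∧ (∀ (x : ℤ) (τ : Tau S.d), 0 ≤ σ.M₀ I x τ) ∧
    ∀ (x : ℤ) (τ : Tau S.d), (Λ.B.card : ℝ) * σ.P * (σ.M₀ I x τ * (σ.Xb I : ℝ) ^ (∑ j, τ.2 j) *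
      ((MonomialDen.monDen S.toQ.all (S.boxExp (σ.Dbox I) (σ.Dθ I) x) : ℝ)) ^ 2) ≤ KTwo σ I x τ := by
  obtain ⟨i, hi, _⟩ := hadm.exists_ne
  have hBw0 : 0 ≤ σ.Bw I := by
    have h := hadm.wt i hi 0 0
    rw [pow_zero, mul_one] at h
    exact (norm_nonneg _).trans h
  have hP0 : 0 ≤ σ.P := (abs_nonneg _).trans (hadm.p_le i hi)
  have hM0 : ∀ (x : ℤ) (τ : Tau S.d), 0 ≤ σ.M₀ I x τ := by
    intro x τ
    obtain ⟨z₀, _, hz₀⟩ := hadm.hasse i hi x τ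
    exact (abs_nonneg _).trans hz₀
  refine ⟨hBw0, hP0, hM0, fun x τ => ?_⟩
  unfold KTwo
  have hcard : (Λ.B.card : ℝ) ≤ σ.cardB I := by exact_mod_cast hadm.card_le
  have hbr : (0 : ℝ) ≤ σ.M₀ I x τ * (σ.Xb I : ℝ) ^ (∑ j, τ.2 j) *
      ((MonomialDen.monDen S.toQ.all (S.boxExp (σ.Dbox I) (σ.Dθ I) x) : ℝ)) ^ 2 := by
    have h1 : (0 : ℝ) ≤ σ.M₀ I x τ := by exact_mod_cast hM0 x τ
    have h2 : (0 : ℝ) ≤ (σ.Xb I : ℝ) ^ (∑ j, τ.2 j) := pow_nonneg (by exact_mod_cast hXb) _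
    positivity
  have hP0' : (0 : ℝ) ≤ σ.P := by exact_mod_cast hP0
  exact mul_le_mul_of_nonneg_right (mul_le_mul_of_nonneg_right hcard hP0') hbr

/-- **THE INNER CHAIN OF LEVEL `I` FROM THE RECORD'S NUMERICS**: `KFinalTwo σ I → KChainTwo σ Sh I` (for
every shape predicate `Sh`).  Sub-step `0` runs from the nodes coprime to `3` (`g3_slab_kstep_cop`), sub-steps
`k ≥ 1` from all nodes (`g3_slab_kstep_Icc`). [cite: Yu2013, Lemma 5.2] [cite: Nesterenko2003, §4.1 (4.3)–(4.5)] -/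
theorem kchainTwo_of_kfinal {I : ℕ} (hfin : KFinalTwo σ I) : KChainTwo σ Sh I := by
  intro Λ hadm hvan
  obtain ⟨hBw0, hP0, hM0, hK⟩ := kstep_data_of_adm σ Sh hadm hfin.Xb_nonneg
  have ht : 1 ≤ σ.tdec I := hfin.one_le_tdec
  -- the hypotheses of the k-step, read off admissibility
  have hR : ∀ (x : ℤ) (τ : Tau S.d), ∀ i ∈ Λ.B, ∃ z₀ : ℤ,
      (σ.den₀ I x τ : ℚ) * (hasseDeriv τ.1 (Λ.R i)).eval (x : ℚ) = z₀ ∧ |z₀| ≤ σ.M₀ I x τ :=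
    fun x τ i hi => hadm.hasse i hi x τ
  -- the claim after `k ≥ 1` sub-steps
  have hchain : ∀ k, 1 ≤ k → k ≤ σ.kst I →
      Λ.vanish nodesAll (σ.Nsub I k) (σ.T0 I - k * σ.tdec I) := by
    intro k
    induction k with
    | zero => intro h; omega
    | succ k ih =>
      intro _ hk
      rcases Nat.eq_zero_or_pos k with hk0 | hkpos
      · -- sub-step `0`: from the coprime nodes
        subst hk0
        have hzero : ∀ x : ℤ, |x| ≤ (σ.Nsub I 0 : ℤ) → ¬ (3 : ℤ) ∣ x → ∀ τ'' : Tau S.d,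
            tauNorm τ'' < σ.T0 I → S.g3φ Λ.R Λ.u Λ.uθ Λ.B Λ.p τ'' x = 0 := by
          intro x hx h3 τ'' hτ''
          rw [hfin.Nsub_zero] at hx
          exact hvan x hx h3 τ'' hτ''
        have hfinal0 := hfin.hfinal 0 (by omega)
        simp only [gainExp, if_true, Nat.zero_mul, Nat.sub_zero, zero_add] at hfinal0
        have key := S.g3_slab_kstep_cop Λ.R Λ.u Λ.uθ Λ.B Λ.p Λ.i₀ hadm.slab (N := σ.Nsub I 0)
          (N' := σ.Nsub I 1) (Tlo := σ.T0 I) ht hBw0 hadm.wt hzero hadm.u_le hadm.uθ_le (σ.den₀ I)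
          hfin.one_le_den₀ (σ.M₀ I) hR hadm.dir_le hadm.p_le (KTwo σ I) hfin.KTwo_pos hK hfinal0
        intro x hx _ τ hτ
        exact key x hx τ (by omega)
      · -- sub-step `k ≥ 1`: from all the nodes
        have hprev := ih hkpos (by omega)
        have hzero : ∀ x : ℤ, |x| ≤ (σ.Nsub I k : ℤ) → ∀ τ'' : Tau S.d,
            tauNorm τ'' < σ.T0 I - k * σ.tdec I → S.g3φ Λ.R Λ.u Λ.uθ Λ.B Λ.p τ'' x = 0 :=
          fun x hx τ'' hτ'' => hprev x hx trivial τ'' hτ''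
        have hfinalk := hfin.hfinal k (by omega)
        have hk0' : k ≠ 0 := by omega
        simp only [gainExp, hk0', if_false] at hfinalk
        have key := S.g3_slab_kstep_Icc Λ.R Λ.u Λ.uθ Λ.B Λ.p Λ.i₀ hadm.slab (N := σ.Nsub I k)
          (N' := σ.Nsub I (k + 1)) (Tlo := σ.T0 I - k * σ.tdec I) ht hBw0 hadm.wt hzero hadm.u_le
          hadm.uθ_le (σ.den₀ I) hfin.one_le_den₀ (σ.M₀ I) hR hadm.dir_le hadm.p_le (KTwo σ I)
          hfin.KTwo_pos hK hfinalk
        intro x hx _ τ hτ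
        refine key x hx τ ?_
        rw [Nat.succ_mul] at hτ
        omega
  -- the level's final range and order
  have hlast := hchain (σ.kst I) hfin.one_le_kst le_rfl
  refine Λ.vanish_mono hfin.Nfin_le ?_ hlast
  have := hfin.Tfin_le
  omega

/-- **`mainTwo` with the inner chains discharged from the record's numerics**: Siegel + `KFinalTwo` at every
level `I ≤ Istar` + the third steps ⇒ the last-level admissible family with its vanishing.
[cite: Yu2013, §5 (5.19)–(5.20); shape only] -/
theorem mainTwo_of_kfinal (hS : SiegelTwo σ Sh) (hfin : ∀ I, I ≤ σ.Istar → KFinalTwo σ I)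
    (hth : ∀ I, I < σ.Istar → ThirdStepTwo σ Sh I) :
    ∃ Λ : S.G3Fam ι, S.G3Adm σ Sh σ.Istar Λ ∧ Λ.vanish nodesAll (σ.Nfin σ.Istar) (σ.Tfin σ.Istar) :=
  mainTwo σ Sh hS (fun I hI => kchainTwo_of_kfinal σ Sh (hfin I hI)) hth

/-- **`FrameOutputTwo` with the inner chains discharged from the record's numerics.**
[cite: Nesterenko2003, §5.1 (5.1)–(5.4)] [cite: Yu2013, §6; shape only] -/
theorem frameOutputTwo_of_kfinal (hS : SiegelTwo σ Sh) (hfin : ∀ I, I ≤ σ.Istar → KFinalTwo σ I)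
    (hth : ∀ I, I < σ.Istar → ThirdStepTwo σ Sh I) {X S₀ : ℕ}
    (hX : (S.d + 1 + 1) * X ≤ σ.Nfin σ.Istar) (hT : (S.d + 1 + 1) * S₀ < σ.Tfin σ.Istar) :
    GenThreeFrameSpecTwo.FrameOutputTwo (S.d + 1) S.toQ.all S.ball (Fin.last S.d) σ.D₀ S₀ X
      (Fin.snoc (σ.Dbox σ.Istar) (σ.Dθ σ.Istar)) :=
  frameOutputTwo_of_mainTwo σ Sh hS (fun I hI => kchainTwo_of_kfinal σ Sh (hfin I hI)) hth hX hT

end TwoSetup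

end Summit.ABC.StewartYu

end
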